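import Mathlib
import Literature.Analysis.DeBrangesSpaces.HalfPlaneCauchy
import Literature.Analysis.FunctionSpaces.PlancherelL1L2
import Literature.Analysis.Fourier.FourierUniquenessL1
import HarnessLib

/-!
# Paley–Wiener for the upper half-plane, by duality

Topic `Literature/Analysis/DeBrangesSpaces` (support file: theorems only, no definitions, no named
facts). Let `g` be complex differentiable at every point of the closed upper half-plane, with
`∫_ℝ ‖g(x)‖² dx < ∞` and the mild decay `‖g(z)‖ ≤ C/√(Im z)` for `Im z > 0`, `‖z‖ ≥ R₀` (the
hypotheses of the tree's half-plane Cauchy formulas `integral_div_sub_eq_of_im_pos`,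
`integral_div_sub_eq_zero_of_im_neg`). Put `ψ := 𝓕⁻¹ĝ ∈ L²(ℝ)` where `ĝ(ξ) = g(−2πξ)` and `𝓕` is
Mathlib's unitary Fourier transform of `L²(ℝ)` (so that `∫ ψ(x)e^{iux}dx = g(u)`: Suzuki's /
de Branges' convention `f̂(z) = ∫ f(x)e^{izx}dx`). Then

* `integral_Ioi_fourierInv_mul_cexp_eq` — `∫₀^∞ ψ(x) e^{iwx} dx = g(w)` for every `w` in the open
  upper half-plane (Parseval against the Cauchy kernel `1_{x>0}e^{−iw̄x}`, whose transform is
  `1/(i(w̄ + 2πξ))`, and Cauchy's formula along `ℝ`);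
* `fourierInv_ae_eq_zero_of_neg` — `ψ = 0` a.e. on `(−∞, 0)` (Parseval against `1_{x<0}e^{−iāx}`,
  `Im a < 0`, Cauchy's theorem along `ℝ`, and injectivity of the Fourier transform on `L¹`).

Together: `g|_{ℂ₊}` is the Fourier–Laplace transform of the `L²(0,∞)`-function `ψ` — the Paley–Wiener
theorem for `H²` of the half-plane (Rudin, *Real and complex analysis*, Thm. 19.2; Dym–McKean §2.7)
for functions regular up to the boundary, proved by duality. All statements are folklore.
-/

noncomputable section

namespace Literature.Analysis.DeBrangesSpaces

open _root_.MeasureTheory _root_.Complex Set Filter FourierTransform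
open scoped ComplexConjugate FourierTransform Topology Real ENNReal InnerProductSpace

/-! ## The boundary class `ĝ(ξ) = g(−2πξ)` -/

/-- `L²(ℝ)` is stable under the dilation `ξ ↦ aξ`, `a ≠ 0`. [folklore] -/
private theorem memLp_two_comp_mul_left {P : ℝ → ℂ} (hP : MemLp P 2 volume) {a : ℝ} (ha : a ≠ 0) :
    MemLp (fun ξ : ℝ ↦ P (a * ξ)) 2 volume :=
  (hP.smul_measure ENNReal.ofReal_ne_top).comp_measurePreserving
    ⟨measurable_const_mul a, Real.map_volume_mul_left ha⟩

/-- If `g` is continuous along `ℝ` (e.g. differentiable at every point of the closed upper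
half-plane) and `∫‖g(x)‖²dx < ∞`, then `ξ ↦ g(−2πξ)` is in `L²(ℝ)` (the boundary function of
an `H²` function, read in Mathlib's Fourier variable). [cite: Rudin1987, Thm. 19.2] -/
theorem memLp_two_boundary_dilate {g : ℂ → ℂ} (hd : ∀ z : ℂ, 0 ≤ z.im → DifferentiableAt ℂ g z)
    (hi : Integrable fun x : ℝ ↦ ‖g x‖ ^ 2) :
    MemLp (fun ξ : ℝ ↦ g ((-(2 * π) * ξ : ℝ) : ℂ)) 2 volume := by
  have hmeas : AEStronglyMeasurable (fun x : ℝ ↦ g x) volume :=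
    aestronglyMeasurable_ofReal_of_differentiableAt hd
  have hP : MemLp (fun x : ℝ ↦ g x) 2 volume :=
    (memLp_two_iff_integrable_sq_norm hmeas).2 hi
  exact memLp_two_comp_mul_left hP (neg_ne_zero.2 Real.two_pi_pos.ne')

/-! ## Cauchy kernels on half-lines and their Fourier transforms -/

/-- `∫₀^∞ e^{ax} e^{−2πixξ} dx = 1/(2πiξ − a)` for `Re a < 0`. [folklore] -/
private theorem fourier_indicator_Ioi_cexp {a : ℂ} (ha : a.re < 0) (ξ : ℝ) :
    𝓕 ((Ioi (0 : ℝ)).indicator fun x : ℝ ↦ cexp (a * x)) ξ = 1 / (2 * π * I * ξ - a) := by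
  rw [Real.fourier_real_eq_integral_exp_smul]
  have h1 : ∀ v : ℝ, cexp (↑(-2 * π * v * ξ) * I) • (Ioi (0 : ℝ)).indicator
      (fun x : ℝ ↦ cexp (a * x)) v =
      (Ioi (0 : ℝ)).indicator (fun x : ℝ ↦ cexp ((a - 2 * π * I * ξ) * x)) v := by
    intro v
    by_cases hv : v ∈ Ioi (0 : ℝ)
    · rw [indicator_of_mem hv, indicator_of_mem hv, smul_eq_mul, ← Complex.exp_add]
      congr 1
      push_cast
      ring
    · rw [indicator_of_notMem hv, indicator_of_notMem hv, smul_zero]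
  simp_rw [h1]
  rw [integral_indicator measurableSet_Ioi]
  have hre : (a - 2 * π * I * ξ).re < 0 := by
    simp [Complex.mul_re, Complex.mul_im]; linarith
  rw [integral_exp_mul_complex_Ioi hre 0]
  simp only [Complex.ofReal_zero, mul_zero, Complex.exp_zero]
  rw [show (2 * π * I * ξ - a : ℂ) = -(a - 2 * π * I * ξ) by ring, one_div_neg_eq_neg_one_div,
    neg_div]

/-- `∫_{−∞}^0 e^{ax} e^{−2πixξ} dx = 1/(a − 2πiξ)` for `Re a > 0`. [folklore] -/
private theorem fourier_indicator_Iio_cexp {a : ℂ} (ha : 0 < a.re) (ξ : ℝ) :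
    𝓕 ((Iio (0 : ℝ)).indicator fun x : ℝ ↦ cexp (a * x)) ξ = 1 / (a - 2 * π * I * ξ) := by
  rw [Real.fourier_real_eq_integral_exp_smul]
  have h1 : ∀ v : ℝ, cexp (↑(-2 * π * v * ξ) * I) • (Iio (0 : ℝ)).indicator
      (fun x : ℝ ↦ cexp (a * x)) v =
      (Iio (0 : ℝ)).indicator (fun x : ℝ ↦ cexp ((a - 2 * π * I * ξ) * x)) v := by
    intro v
    by_cases hv : v ∈ Iio (0 : ℝ)
    · rw [indicator_of_mem hv, indicator_of_mem hv, smul_eq_mul, ← Complex.exp_add]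
      congr 1
      push_cast
      ring
    · rw [indicator_of_notMem hv, indicator_of_notMem hv, smul_zero]
  simp_rw [h1]
  rw [integral_indicator measurableSet_Iio]
  have hre : 0 < (a - 2 * π * I * ξ).re := by
    simp [Complex.mul_re, Complex.mul_im]; linarith
  rw [← integral_Iic_eq_integral_Iio, integral_exp_mul_complex_Iic hre 0]
  simp only [Complex.ofReal_zero, mul_zero, Complex.exp_zero]

/-- The half-line exponential `1_{(0,∞)} e^{ax}`, `Re a < 0`, is integrable. [folklore] -/
private theorem integrable_indicator_Ioi_cexp {a : ℂ} (ha : a.re < 0) :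
    Integrable ((Ioi (0 : ℝ)).indicator fun x : ℝ ↦ cexp (a * x)) :=
  (integrableOn_exp_mul_complex_Ioi ha 0).integrable_indicator measurableSet_Ioi

/-- The half-line exponential `1_{(−∞,0)} e^{ax}`, `Re a > 0`, is integrable. [folklore] -/
private theorem integrable_indicator_Iio_cexp {a : ℂ} (ha : 0 < a.re) :
    Integrable ((Iio (0 : ℝ)).indicator fun x : ℝ ↦ cexp (a * x)) := by
  have h := (integrableOn_exp_mul_complex_Iic ha 0)
  rw [integrableOn_Iic_iff_integrableOn_Iio] at h
  exact h.integrable_indicator measurableSet_Iio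

/-- The half-line exponential `1_{(0,∞)} e^{ax}`, `Re a < 0`, is square-integrable. [folklore] -/
private theorem memLp_two_indicator_Ioi_cexp {a : ℂ} (ha : a.re < 0) :
    MemLp ((Ioi (0 : ℝ)).indicator fun x : ℝ ↦ cexp (a * x)) 2 volume := by
  have hmeas : AEStronglyMeasurable ((Ioi (0 : ℝ)).indicator fun x : ℝ ↦ cexp (a * x)) volume :=
    (integrable_indicator_Ioi_cexp ha).aestronglyMeasurable
  refine (memLp_two_iff_integrable_sq_norm hmeas).2 ?_
  have h2 : (2 * a).re < 0 := by simp; linarith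
  refine ((integrable_indicator_Ioi_cexp h2).norm).congr (Eventually.of_forall fun x ↦ ?_)
  by_cases hx : x ∈ Ioi (0 : ℝ)
  · simp only [indicator_of_mem hx, Complex.norm_exp]
    rw [← Real.exp_nat_mul]
    congr 1
    simp [Complex.mul_re]
    ring
  · simp [indicator_of_notMem hx]

/-- The half-line exponential `1_{(−∞,0)} e^{ax}`, `Re a > 0`, is square-integrable. [folklore] -/
private theorem memLp_two_indicator_Iio_cexp {a : ℂ} (ha : 0 < a.re) :
    MemLp ((Iio (0 : ℝ)).indicator fun x : ℝ ↦ cexp (a * x)) 2 volume := by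
  have hmeas : AEStronglyMeasurable ((Iio (0 : ℝ)).indicator fun x : ℝ ↦ cexp (a * x)) volume :=
    (integrable_indicator_Iio_cexp ha).aestronglyMeasurable
  refine (memLp_two_iff_integrable_sq_norm hmeas).2 ?_
  have h2 : 0 < (2 * a).re := by simp; linarith
  refine ((integrable_indicator_Iio_cexp h2).norm).congr (Eventually.of_forall fun x ↦ ?_)
  by_cases hx : x ∈ Iio (0 : ℝ)
  · simp only [indicator_of_mem hx, Complex.norm_exp]
    rw [← Real.exp_nat_mul]
    congr 1
    simp [Complex.mul_re]
    ring
  · simp [indicator_of_notMem hx]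


/-! ## Parseval against a test function -/

/-- `⟪φ, ψ⟫_{L²} = ∫ ψ · conj φ` for an honest function `φ ∈ L²` and a class `ψ`. [folklore] -/
private theorem inner_toLp_eq_integral {φ : ℝ → ℂ} (hφ : MemLp φ 2 volume)
    (ψ : Lp ℂ 2 (volume : Measure ℝ)) :
    ⟪(hφ.toLp φ : Lp ℂ 2 (volume : Measure ℝ)), ψ⟫_ℂ = ∫ x : ℝ, ψ x * conj (φ x) := by
  rw [L2.inner_def]
  refine integral_congr_ae ?_
  filter_upwards [hφ.coeFn_toLp] with x hx
  rw [RCLike.inner_apply, hx]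

/-- **Parseval/Plancherel duality**: for `φ ∈ L¹ ∩ L²` and the class `ψ := 𝓕⁻¹G`, `G ∈ L²`,
`⟪φ, ψ⟫ = ⟪𝓕φ, G⟫ = ∫ G · conj(𝓕φ)`, with `𝓕φ` the Fourier INTEGRAL of `φ`. [folklore] -/
private theorem inner_toLp_fourierInv_eq_integral {φ G : ℝ → ℂ} (hφ1 : Integrable φ)
    (hφ2 : MemLp φ 2 volume) (hG : MemLp G 2 volume) :
    ⟪(hφ2.toLp φ : Lp ℂ 2 (volume : Measure ℝ)),
        (𝓕⁻ (hG.toLp G : Lp ℂ 2 (volume : Measure ℝ)) : Lp ℂ 2 (volume : Measure ℝ))⟫_ℂ =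
      ∫ ξ : ℝ, G ξ * conj (𝓕 φ ξ) := by
  rw [← Lp.inner_fourier_eq, fourier_fourierInv_eq (hG.toLp G : Lp ℂ 2 (volume : Measure ℝ)),
    L2.inner_def]
  refine integral_congr_ae ?_
  filter_upwards [hG.coeFn_toLp,
    Literature.Analysis.FunctionSpaces.fourier_toLp_ae_eq_fourierIntegral hφ1 hφ2] with ξ h1 h2
  rw [RCLike.inner_apply, h1, h2]

/-- The substitution `u = −2πξ`: `∫ h(−2πξ) dξ = (2π)⁻¹ ∫ h(u) du`. [folklore] -/
private theorem integral_comp_neg_two_pi_mul (h : ℝ → ℂ) :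
    ∫ ξ : ℝ, h (-(2 * π) * ξ) = ((2 * π)⁻¹ : ℝ) • ∫ u : ℝ, h u := by
  rw [Measure.integral_comp_mul_left h (-(2 * π)), abs_inv, abs_neg, abs_of_pos Real.two_pi_pos]

/-! ## Paley–Wiener by duality -/

section PW

variable {g : ℂ → ℂ} {C R₀ : ℝ}

/-- **Fourier–Laplace representation on the upper half-plane.** With `ψ := 𝓕⁻¹ĝ`,
`ĝ(ξ) = g(−2πξ)`: `∫₀^∞ ψ(x) e^{iwx} dx = g(w)` for `Im w > 0`, for `g` complex differentiable on the
closed upper half-plane with `∫_ℝ‖g‖² < ∞` and `‖g(z)‖ ≤ C/√(Im z)` for large `‖z‖`. Proof: Parseval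
against `1_{(0,∞)}e^{−iw̄x}` (transform `1/(i(w̄ + 2πξ))`) and Cauchy's formula along `ℝ`
(`integral_div_sub_eq_of_im_pos`). [cite: Rudin1987, Thm. 19.2] -/
theorem integral_Ioi_fourierInv_mul_cexp_eq (hC : 0 ≤ C)
    (hd : ∀ z : ℂ, 0 ≤ z.im → DifferentiableAt ℂ g z)
    (hi : Integrable fun x : ℝ ↦ ‖g x‖ ^ 2)
    (hb : ∀ z : ℂ, 0 < z.im → R₀ ≤ ‖z‖ → ‖g z‖ ≤ C / √z.im)
    (hG : MemLp (fun ξ : ℝ ↦ g ((-(2 * π) * ξ : ℝ) : ℂ)) 2 volume)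
    {w : ℂ} (hw : 0 < w.im) :
    ∫ x in Ioi (0 : ℝ),
        ((𝓕⁻ (hG.toLp _ : Lp ℂ 2 (volume : Measure ℝ)) : Lp ℂ 2 (volume : Measure ℝ)) : ℝ → ℂ) x
          * cexp (I * w * x) = g w := by
  set ψ : Lp ℂ 2 (volume : Measure ℝ) :=
    𝓕⁻ (hG.toLp _ : Lp ℂ 2 (volume : Measure ℝ)) with hψ
  -- the Cauchy kernel `φ(x) = 1_{(0,∞)} e^{ax}`, `a = −i w̄`
  set a : ℂ := -(I * conj w) with ha_def
  have ha : a.re < 0 := by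
    rw [ha_def, neg_re, Complex.mul_re, Complex.I_re, Complex.I_im, Complex.conj_re,
      Complex.conj_im]
    linarith
  set φ : ℝ → ℂ := (Ioi (0 : ℝ)).indicator fun x : ℝ ↦ cexp (a * x) with hφ_def
  have hφ1 : Integrable φ := integrable_indicator_Ioi_cexp ha
  have hφ2 : MemLp φ 2 volume := memLp_two_indicator_Ioi_cexp ha
  -- (1) the left-hand side is `⟪φ, ψ⟫`
  have hconj : ∀ x : ℝ, conj (φ x) = (Ioi (0 : ℝ)).indicator (fun x : ℝ ↦ cexp (I * w * x)) x := by
    intro x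
    by_cases hx : x ∈ Ioi (0 : ℝ)
    · rw [hφ_def, indicator_of_mem hx, indicator_of_mem hx, ← Complex.exp_conj, map_mul,
        Complex.conj_ofReal, ha_def, map_neg, map_mul, Complex.conj_I, Complex.conj_conj]
      ring_nf
    · rw [hφ_def, indicator_of_notMem hx, indicator_of_notMem hx, map_zero]
  have h1 : ⟪(hφ2.toLp φ : Lp ℂ 2 (volume : Measure ℝ)), ψ⟫_ℂ =
      ∫ x in Ioi (0 : ℝ), (ψ : ℝ → ℂ) x * cexp (I * w * x) := by
    rw [inner_toLp_eq_integral, ← integral_indicator measurableSet_Ioi]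
    refine integral_congr_ae (Eventually.of_forall fun x ↦ ?_)
    show (ψ : ℝ → ℂ) x * conj (φ x) = _
    rw [hconj]
    by_cases hx : x ∈ Ioi (0 : ℝ)
    · rw [indicator_of_mem hx, indicator_of_mem hx]
    · rw [indicator_of_notMem hx, indicator_of_notMem hx, mul_zero]
  -- (2) Parseval: `⟪φ, ψ⟫ = ∫ g(−2πξ) conj(𝓕φ(ξ)) dξ`, and `conj 𝓕φ(ξ) = 1/(i(−2πξ − w))`
  have h2 : ⟪(hφ2.toLp φ : Lp ℂ 2 (volume : Measure ℝ)), ψ⟫_ℂ =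
      ∫ ξ : ℝ, (fun u : ℝ ↦ g u / (I * ((u : ℂ) - w))) (-(2 * π) * ξ) := by
    rw [hψ, inner_toLp_fourierInv_eq_integral hφ1 hφ2 hG]
    refine integral_congr_ae (Eventually.of_forall fun ξ ↦ ?_)
    have hden : conj (2 * π * I * ξ - a) = I * (((-(2 * π) * ξ : ℝ) : ℂ) - w) := by
      rw [ha_def]
      simp only [map_sub, map_mul, map_neg, Complex.conj_I, Complex.conj_conj,
        Complex.conj_ofReal, map_ofNat]
      push_cast
      ring
    show g _ * conj (𝓕 φ ξ) = g _ / _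
    rw [hφ_def, fourier_indicator_Ioi_cexp ha ξ, map_div₀, map_one, hden]
    ring
  -- (3) substitution `u = −2πξ` and Cauchy's formula
  have h3 : ∫ ξ : ℝ, (fun u : ℝ ↦ g u / (I * ((u : ℂ) - w))) (-(2 * π) * ξ) = g w := by
    rw [integral_comp_neg_two_pi_mul (fun u : ℝ ↦ g u / (I * ((u : ℂ) - w)))]
    have h4 : ∫ u : ℝ, g u / (I * ((u : ℂ) - w)) = I⁻¹ * ∫ u : ℝ, g u / ((u : ℂ) - w) := by
      rw [← integral_const_mul]
      refine integral_congr_ae (Eventually.of_forall fun u ↦ ?_)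
      show g u / (I * ((u : ℂ) - w)) = I⁻¹ * (g u / ((u : ℂ) - w))
      rw [mul_comm I, ← div_div, div_eq_mul_inv _ I, mul_comm _ I⁻¹]
    rw [h4, integral_div_sub_eq_of_im_pos hC hd hi hb hw, Complex.real_smul]
    have h2π : (2 * (π : ℂ)) ≠ 0 := mul_ne_zero two_ne_zero (Complex.ofReal_ne_zero.2 Real.pi_ne_zero)
    calc (((2 * π)⁻¹ : ℝ) : ℂ) * (I⁻¹ * (2 * π * I * g w))
        = (((2 * π)⁻¹ : ℝ) : ℂ) * (2 * π) * ((I⁻¹ * I) * g w) := by ring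
      _ = g w := by
          rw [inv_mul_cancel₀ I_ne_zero, one_mul]
          push_cast
          rw [inv_mul_cancel₀ h2π, one_mul]
  rw [← h1, h2, h3]

/-- **Support in `[0, ∞)`.** With `ψ := 𝓕⁻¹ĝ` as above, `ψ = 0` almost everywhere on `(−∞, 0)`:
Parseval against `1_{(−∞,0)}e^{(1 − 2πiξ)x}` gives `∫_{−∞}^0 eˣ e^{−2πixξ}·… ψ = (i/2π)∫ g(u)/(u − a) du`
with `Im a = −1 < 0`, which vanishes by Cauchy's theorem along `ℝ`
(`integral_div_sub_eq_zero_of_im_neg`); so the integrable function `1_{(−∞,0)}eˣψ` has vanishing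
Fourier transform and is `0` a.e. (`ae_eq_zero_of_forall_fourier_eq_zero`). This is the
Paley–Wiener theorem `H²(ℂ₊) = 𝖥L²(0,∞)` for boundary-regular `g`. [cite: Rudin1987, Thm. 19.2] -/
theorem fourierInv_ae_eq_zero_of_neg (hC : 0 ≤ C)
    (hd : ∀ z : ℂ, 0 ≤ z.im → DifferentiableAt ℂ g z)
    (hi : Integrable fun x : ℝ ↦ ‖g x‖ ^ 2)
    (hb : ∀ z : ℂ, 0 < z.im → R₀ ≤ ‖z‖ → ‖g z‖ ≤ C / √z.im)
    (hG : MemLp (fun ξ : ℝ ↦ g ((-(2 * π) * ξ : ℝ) : ℂ)) 2 volume) :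
    ∀ᵐ x : ℝ, x < 0 →
      ((𝓕⁻ (hG.toLp _ : Lp ℂ 2 (volume : Measure ℝ)) : Lp ℂ 2 (volume : Measure ℝ)) : ℝ → ℂ) x
        = 0 := by
  set ψ : Lp ℂ 2 (volume : Measure ℝ) :=
    𝓕⁻ (hG.toLp _ : Lp ℂ 2 (volume : Measure ℝ)) with hψ
  -- the integrable function `k = 1_{(−∞,0)} eˣ ψ`
  set k : ℝ → ℂ := fun x ↦ (Iio (0 : ℝ)).indicator (fun x : ℝ ↦ cexp ((1 : ℂ) * x)) x * ψ x
    with hk_def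
  have hk : Integrable k :=
    (memLp_two_indicator_Iio_cexp (a := 1) (by simp)).integrable_mul (Lp.memLp ψ)
  -- its Fourier transform vanishes identically
  have hFk : ∀ ξ : ℝ, 𝓕 k ξ = 0 := by
    intro ξ
    -- the test function `φ(x) = 1_{(−∞,0)} e^{bx}`, `b = 1 + 2πiξ`
    set b : ℂ := 1 + 2 * π * I * ξ with hb_def
    have hbre : 0 < b.re := by simp [hb_def, Complex.mul_re, Complex.mul_im]
    set φ : ℝ → ℂ := (Iio (0 : ℝ)).indicator fun x : ℝ ↦ cexp (b * x) with hφ_def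
    have hφ1 : Integrable φ := integrable_indicator_Iio_cexp hbre
    have hφ2 : MemLp φ 2 volume := memLp_two_indicator_Iio_cexp hbre
    -- `𝓕 k ξ = ⟪φ, ψ⟫`
    have e1 : 𝓕 k ξ = ⟪(hφ2.toLp φ : Lp ℂ 2 (volume : Measure ℝ)), ψ⟫_ℂ := by
      rw [inner_toLp_eq_integral, Real.fourier_real_eq_integral_exp_smul]
      refine integral_congr_ae (Eventually.of_forall fun x ↦ ?_)
      show cexp (↑(-2 * π * x * ξ) * I) • k x = (ψ : ℝ → ℂ) x * conj (φ x)
      simp only [hk_def, hφ_def, smul_eq_mul]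
      by_cases hx : x ∈ Iio (0 : ℝ)
      · have hconjb : conj (cexp (b * x)) = cexp (↑(-2 * π * x * ξ) * I) * cexp ((1 : ℂ) * x) := by
          rw [← Complex.exp_conj, ← Complex.exp_add, hb_def]
          congr 1
          simp only [map_mul, map_add, map_one, Complex.conj_I, Complex.conj_ofReal, map_ofNat]
          push_cast
          ring
        rw [indicator_of_mem hx, indicator_of_mem hx, hconjb]
        ring
      · rw [indicator_of_notMem hx, indicator_of_notMem hx, zero_mul, mul_zero, map_zero,
          mul_zero]
    -- Parseval and the Cauchy kernel: `⟪φ, ψ⟫ = (2π)⁻¹ ∫ g(u)/(−i(u − a)) du`, `a = −2πξ − i`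
    set a : ℂ := ((-(2 * π) * ξ : ℝ) : ℂ) - I with ha_def
    have haim : a.im < 0 := by simp [ha_def]
    have e2 : ⟪(hφ2.toLp φ : Lp ℂ 2 (volume : Measure ℝ)), ψ⟫_ℂ =
        ∫ ζ : ℝ, (fun u : ℝ ↦ g u / (-I * ((u : ℂ) - a))) (-(2 * π) * ζ) := by
      rw [hψ, inner_toLp_fourierInv_eq_integral hφ1 hφ2 hG]
      refine integral_congr_ae (Eventually.of_forall fun ζ ↦ ?_)
      have hden : conj (b - 2 * π * I * ζ) = -I * (((-(2 * π) * ζ : ℝ) : ℂ) - a) := by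
        rw [hb_def, ha_def]
        simp only [map_sub, map_mul, map_add, map_one, Complex.conj_I, Complex.conj_ofReal,
          map_ofNat]
        push_cast
        ring_nf
        rw [Complex.I_sq]
        ring
      show g _ * conj (𝓕 φ ζ) = g _ / _
      rw [hφ_def, fourier_indicator_Iio_cexp hbre ζ, map_div₀, map_one, hden]
      ring
    have e3 : ∫ ζ : ℝ, (fun u : ℝ ↦ g u / (-I * ((u : ℂ) - a))) (-(2 * π) * ζ) = 0 := by
      rw [integral_comp_neg_two_pi_mul (fun u : ℝ ↦ g u / (-I * ((u : ℂ) - a)))]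
      have h4 : ∫ u : ℝ, g u / (-I * ((u : ℂ) - a)) = (-I)⁻¹ * ∫ u : ℝ, g u / ((u : ℂ) - a) := by
        rw [← integral_const_mul]
        refine integral_congr_ae (Eventually.of_forall fun u ↦ ?_)
        show g u / (-I * ((u : ℂ) - a)) = (-I)⁻¹ * (g u / ((u : ℂ) - a))
        rw [mul_comm (-I), ← div_div, div_eq_mul_inv _ (-I), mul_comm _ (-I)⁻¹]
      rw [h4, integral_div_sub_eq_zero_of_im_neg hC hd hi hb haim, mul_zero, smul_zero]
    rw [e1, e2, e3]
  -- hence `k = 0` a.e., i.e. `ψ = 0` a.e. on `(−∞, 0)`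
  have hk0 := Literature.Analysis.Fourier.ae_eq_zero_of_forall_fourier_eq_zero hk hFk
  filter_upwards [hk0] with x hx hneg
  have hx' : (Iio (0 : ℝ)).indicator (fun x : ℝ ↦ cexp ((1 : ℂ) * x)) x * ψ x = 0 := hx
  rw [indicator_of_mem (show x ∈ Iio (0 : ℝ) from hneg)] at hx'
  exact (mul_eq_zero.1 hx').resolve_left (Complex.exp_ne_zero _)

end PW

end Literature.Analysis.DeBrangesSpaces
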